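import Literature.MathematicalPhysics.StatisticalMechanics.ComplexSpinChessboard
import HarnessLib

/-!
# Gaussian domination for the complex spin systems of strongly coupled lattice gauge theory
# (Salmhofer–Seiler, CMP 139 (1991), proof of Thm. 3.21: (3.84)–(3.90), (3.95), (3.97))

Fourth instalment of the discharge of the cited fact `SalmhoferSeiler1991_infraredBound` along the
printed proof (pp. 413–415), after `ComplexSpinReflectionPositivity` (Prop. 3.15, Rem. 3.16),
`ComplexSpinExponentialSchwarz` (Thm. 3.20) and `ComplexSpinChessboard` ((3.79)–(3.80), (3.85),
(3.94), (3.96), the chessboard bound in maximiser form).  PROVED here, no named fact introduced: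
the per-plane regrouping (3.84)–(3.88) of `-N H^ε_Λ(φ)`, the reflection Schwarz inequality (3.90)
for the twisted partition functions `Z^ε_Λ(φ)` (3.80), and **Gaussian domination** (3.95) (`ε = 1`,
real `φ`) and (3.97) (`ε = -1`, imaginary `φ`).  Honest framing: finite-volume algebra of
polynomial "spin systems" at `β = 0`; nothing about `β > 0`, the continuum, or the summit's `QCD`
conjunct.

WHAT IS PRINTED (p. 414).  "`H^ε_Λ` can be rewritten as `H^ε_Λ(φ) = H^ε_{Λ₊}(φ) + Θ H^ε_{Λ₊}(φ̄∘r)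
+ H_C(φ)` (3.84), where `H^ε_{Λ₊}(φ) = εν ∑_{x ∈ Λ₊} (σ_x - φ_x)² - ∑_{x,μ} (σ_x - φ_x)(σ_{x+e_μ} -
φ_{x+e_μ})` (3.85) [the second sum is understood to contain only `(x, μ)` for which both `x` and
`x + e_μ` are in `Λ₊`] and `H_C(φ) = -∑_{x : x_1 ∈ {0, L_1}} (σ_x - φ_x)(σ_{x-e_1} - φ_{x-e_1})`
(3.86) consists of the terms coupling `Λ₊` and `Λ₋`, `H_C(φ) = -∑ C_x ΘD_x` (3.87), `C_x = σ_x -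
φ_x`, `D_x = σ_x - φ̄_{rx}` (3.88). … Using Theorem 3.20 which is applicable because `[·]_Λ` is
reflection-positive (normalization does not matter), one sees that `|F_ε(φ^{(0)}, …,
φ^{(L_1-1)})|² ≤ F_ε(φ^{(0)}, …, φ^{(L_1/2-1)}, φ̄^{(L_1/2-1)}, …, φ̄^{(0)}) F_ε(φ̄^{(L_1-1)}, …)`
(3.90), so the abstract chessboard bounds [19] apply … For `ε = 1`, take `φ_x ∈ ℝ` for all `x` …
Gaussian domination `|Z⁺_Λ(φ)| ≤ Z_Λ` (3.95) holds.  For `ε = -1`, take `φ_x ∈ iℝ` … `|Z⁻_Λ(φ)| ≤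
Z_Λ` (3.97)."  (Here `Z_Λ = Z^ε_Λ(0)`, (3.80).)

HOW IT IS TYPED.  All objects are those of the three companion files: the background bracket
`bracketC N f b` with real site data `f` and bond data `b` (`b_k ≥ 0`, the `b_k` of (3.73) in the
application), the observables `siteTerm`/`linkTerm`/`hamFamily` of `-N H^ε_Λ(φ)`, `twistedZ ε N f b
φ = Z^ε_Λ(φ)`, the exponential bracket `expBracketC` and `crossExp` of Thm. 3.20, the symmetrised
configurations `cfgSymP`/`cfgSymM` and `pattern`, `chessboard_cfg`.  New here: the mirror
configuration `mirrorCfg i k φ = φ̄ ∘ r`; the link classes `plusLinkStarts` (both endpoints in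
`Λ₊`), `minusLinkStarts`, `crossUp`/`crossDown` (the crossing links of direction `i`; `CrossIdx`,
`crossSite`); `plusHam i k ε N φ = -N H^ε_{Λ₊}(φ)` (3.85) and `minusHam`; `crossC`/`crossD`/`crossW`
= `C_x`, `D_x`, `N` of (3.87)–(3.88); `expFactor D Q = e^{q₀} e_D^{Q - q₀}` (the polynomial standing
for `e^{Q}` under the bracket).

WHAT IS PROVED (0 sorry, no new `def … : Prop`).
* `reflect_plusHam_mirrorCfg` (`Θ(-N H^ε_{Λ₊}(φ̄∘r)) = -N H^ε_{Λ₋}(φ)`), `sum_crossExp`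
  (`-N H_C = ∑ N C_x ΘD_x`), **(3.84)** `sum_hamFamily_eq_plusHam`.
* `expBracketC_expFactor_mul` (the exponential bracket with two exponential factors in front depends
  only on the total exponent) and **`twistedZ_eq_expBracketC`**:
  `Z^ε_Λ(φ) = [e^{-NH^ε_{Λ₊}(φ)} Θe^{-NH^ε_{Λ₊}(φ̄∘r)} e^{∑ N C_x ΘD_x}]_Λ`, the shape of Thm. 3.20.
* The symmetrised configurations carry the diagonal data (`plusHam_cfgSymP`, `crossD_cfgSymP`, …),
  hence **(3.90)** `twistedZ_schwarz`: `|Z^ε_Λ(ψ)|² ≤ Z^ε_Λ(ψ₊-sym) Z^ε_Λ(ψ₋-sym)` for every plane,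
  with both factors real `≥ 0` (`twistedZ_cfgSymP_real`, `twistedZ_cfgSymM_real`,
  `twistedZ_zero_real`).
* `norm_twistedZ_le_pattern` ((3.91)–(3.93) via `chessboard_cfg`), and **Gaussian domination**
  `gaussianDomination_one` (3.95): `|Z⁺_Λ(φ)| ≤ |Z⁺_Λ(0)|` for real `φ`, `gaussianDomination_negOne`
  (3.97): `|Z⁻_Λ(φ)| ≤ |Z⁻_Λ(0)|` for imaginary `φ` — on the even torus `(ℤ/Lℤ)^ν`, any site data `f`,
  bond data `b ≥ 0`.
Not here (last steps of the printed proof): the identification (3.81)–(3.83) of `Z^ε_Λ(φ)` with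
`Z_Λ ⟨e^{N(σ,-Δφ)}⟩_Λ` resp. `Z_Λ ⟨e^{-N(σ,Δ̄φ)}⟩_Λ` for the ORIGINAL system (background weights
(3.78) vs. `F`, `B`), the second-order expansion of (3.98)–(3.99) and the step "similar to [18]".

## References

* M. Salmhofer, E. Seiler, *Proof of chiral symmetry breaking in strongly coupled lattice gauge
  theory*, Commun. Math. Phys. 139 (1991) 395–432, (3.84)–(3.97), p. 414. [SalmhoferSeiler1991]
* J. Fröhlich, R. Israel, E. H. Lieb, B. Simon, Commun. Math. Phys. 62 (1978) 1–34 (the paper's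
  [19]: Thm. 3.20 and the chessboard bounds). [FrohlichIsraelLiebSimon1978]
* J. Fröhlich, B. Simon, T. Spencer, Commun. Math. Phys. 50 (1976) 79–95 (the paper's [18]:
  Gaussian domination). [FrohlichSimonSpencer1976]
-/

noncomputable section

open MvPolynomial Finset

namespace Literature.MathematicalPhysics.StatisticalMechanics

open Literature.Probability.LatticeModels (TorusSite)
open Literature.Barriers.CriticalPhenomena.NonGibbs

namespace ComplexSpin

variable {ν L : ℕ}

/-! ### The mirror configuration `conj φ ∘ r` and the reflected site and link terms -/

section Mirror

variable {i : Fin ν} {k : ZMod L}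

/-- The mirror configuration `φ̄ ∘ r : y ↦ conj φ(r y)` of (3.84) (`H^ε_Λ(φ) = H^ε_{Λ₊}(φ) +
Θ H^ε_{Λ₊}(φ̄ ∘ r) + H_C(φ)`). [cite: SalmhoferSeiler1991, (3.84)] -/
def mirrorCfg (i : Fin ν) (k : ZMod L) (ψ : TorusSite ν L → ℂ) : TorusSite ν L → ℂ :=
  fun y => starRingEnd ℂ (ψ (siteReflect i k y))

/-- Unfolding the mirror configuration. [cite: SalmhoferSeiler1991, (3.84)] -/
@[simp] theorem mirrorCfg_apply (ψ : TorusSite ν L → ℂ) (y : TorusSite ν L) :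
    mirrorCfg i k ψ y = starRingEnd ℂ (ψ (siteReflect i k y)) := rfl

/-- `Θ` maps the site term of the mirror configuration at `x` to the site term of `φ` at `r x`:
`Θ(-Nεν (σ_x - conj φ_{rx})²) = -Nεν (σ_{rx} - φ_{rx})²`. [cite: SalmhoferSeiler1991, (3.84)–(3.85)] -/
theorem reflect_siteTerm_mirrorCfg (ε : ℤ) (N : ℕ) (ψ : TorusSite ν L → ℂ) (x : TorusSite ν L) :
    reflect i k (siteTerm ε N (mirrorCfg i k ψ) x) = siteTerm ε N ψ (siteReflect i k x) := by
  simp only [siteTerm, mirrorCfg, map_mul, map_pow, map_sub, reflect_C, reflect_X, map_neg,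
    map_natCast, map_intCast, starRingEnd_self_apply]

/-- `Θ` maps the link term of the mirror configuration on `(x, x + e_μ)` to the (unordered) link term
of `φ` on `(r x, r(x + e_μ))`. [cite: SalmhoferSeiler1991, (3.84)–(3.85)] -/
theorem reflect_linkTerm_mirrorCfg (N : ℕ) (ψ : TorusSite ν L → ℂ) (x : TorusSite ν L)
    (μ : Fin ν) :
    reflect i k (linkTerm N (mirrorCfg i k ψ) (x, μ)) =
      C (N : ℂ) * ((X (siteReflect i k x) - C (ψ (siteReflect i k x))) *
        (X (siteReflect i k (x + Pi.single μ 1)) - C (ψ (siteReflect i k (x + Pi.single μ 1))))) := by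
  simp only [linkTerm, mirrorCfg, map_mul, map_sub, reflect_C, reflect_X, map_natCast,
    starRingEnd_self_apply]

/-- For `μ ≠ i` the reflected link starts at `r x`: `Θ(link of φ̄∘r at (x, μ)) = link of φ at
(r x, μ)`. [cite: SalmhoferSeiler1991, (3.84)–(3.85)] -/
theorem reflect_linkTerm_mirrorCfg_of_ne (N : ℕ) (ψ : TorusSite ν L → ℂ) {μ : Fin ν}
    (hμ : μ ≠ i) (x : TorusSite ν L) :
    reflect i k (linkTerm N (mirrorCfg i k ψ) (x, μ)) = linkTerm N ψ (siteReflect i k x, μ) := by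
  rw [reflect_linkTerm_mirrorCfg, siteReflect_add_single_of_ne i k x hμ, linkTerm]

/-- For `μ = i` the reflected link starts at `r (x + e_i)` (the reflection reverses the bonds of
direction `i`). [cite: SalmhoferSeiler1991, (3.84)–(3.85)] -/
theorem reflect_linkTerm_mirrorCfg_self (N : ℕ) (ψ : TorusSite ν L → ℂ) (x : TorusSite ν L) :
    reflect i k (linkTerm N (mirrorCfg i k ψ) (x, i)) =
      linkTerm N ψ (siteReflect i k (x + Pi.single i 1), i) := by
  rw [reflect_linkTerm_mirrorCfg, linkTerm, siteReflect_add_single_self]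
  ring

end Mirror

variable [NeZero L]

/-! ### The four classes of links relative to a reflection plane -/

section Links

variable (i : Fin ν) (k : ZMod L)

/-- Starting points `x ∈ Λ₊` of the links `(x, x + e_μ)` with both endpoints in `Λ₊` ("the second
sum is understood to contain only `(x, μ)` for which both `x` and `x + e_μ` are in `Λ₊`", p. 414).
[cite: SalmhoferSeiler1991, (3.85)] -/
def plusLinkStarts (μ : Fin ν) : Finset (TorusSite ν L) :=
  (halfPlus L i k).filter fun x => x + Pi.single μ 1 ∈ halfPlus L i k

/-- Starting points `x ∈ Λ₋` of the links `(x, x + e_μ)` with both endpoints in `Λ₋`.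
[cite: SalmhoferSeiler1991, (3.84)–(3.85)] -/
def minusLinkStarts (μ : Fin ν) : Finset (TorusSite ν L) :=
  (halfMinus L i k).filter fun x => x + Pi.single μ 1 ∉ halfPlus L i k

/-- Starting points `x ∈ Λ₊` of the links `(x, x + e_μ)` crossing the plane upwards
(`x + e_μ ∈ Λ₋`; empty unless `μ = i`). [cite: SalmhoferSeiler1991, (3.86)] -/
def crossUp (μ : Fin ν) : Finset (TorusSite ν L) :=
  (halfPlus L i k).filter fun x => x + Pi.single μ 1 ∉ halfPlus L i k

/-- Starting points `x ∈ Λ₋` of the links `(x, x + e_μ)` crossing the plane downwards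
(`x + e_μ ∈ Λ₊`; empty unless `μ = i`). [cite: SalmhoferSeiler1991, (3.86)] -/
def crossDown (μ : Fin ν) : Finset (TorusSite ν L) :=
  (halfMinus L i k).filter fun x => x + Pi.single μ 1 ∈ halfPlus L i k

variable {i k}

/-- Membership in `plusLinkStarts`. [cite: SalmhoferSeiler1991, (3.85)] -/
theorem mem_plusLinkStarts {μ : Fin ν} {x : TorusSite ν L} :
    x ∈ plusLinkStarts i k μ ↔ x ∈ halfPlus L i k ∧ x + Pi.single μ 1 ∈ halfPlus L i k := by
  rw [plusLinkStarts, Finset.mem_filter]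

/-- Membership in `minusLinkStarts`. [cite: SalmhoferSeiler1991, (3.84)–(3.85)] -/
theorem mem_minusLinkStarts {μ : Fin ν} {x : TorusSite ν L} :
    x ∈ minusLinkStarts i k μ ↔ x ∈ halfMinus L i k ∧ x + Pi.single μ 1 ∈ halfMinus L i k := by
  rw [minusLinkStarts, Finset.mem_filter, not_mem_halfPlus_iff]

/-- Membership in `crossUp`. [cite: SalmhoferSeiler1991, (3.86)] -/
theorem mem_crossUp {μ : Fin ν} {x : TorusSite ν L} :
    x ∈ crossUp i k μ ↔ x ∈ halfPlus L i k ∧ x + Pi.single μ 1 ∈ halfMinus L i k := by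
  rw [crossUp, Finset.mem_filter, not_mem_halfPlus_iff]

/-- Membership in `crossDown`. [cite: SalmhoferSeiler1991, (3.86)] -/
theorem mem_crossDown {μ : Fin ν} {x : TorusSite ν L} :
    x ∈ crossDown i k μ ↔ x ∈ halfMinus L i k ∧ x + Pi.single μ 1 ∈ halfPlus L i k := by
  rw [crossDown, Finset.mem_filter]

/-- No link of a direction `μ ≠ i` crosses the plane upwards. [cite: SalmhoferSeiler1991, (3.86)] -/
theorem crossUp_of_ne {μ : Fin ν} (hμ : μ ≠ i) : crossUp i k μ = ∅ := by
  ext x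
  simp only [crossUp, Finset.mem_filter, Finset.notMem_empty, iff_false, not_and, not_not]
  exact fun hx => (add_single_mem_halfPlus_iff i k x hμ).2 hx

/-- No link of a direction `μ ≠ i` crosses the plane downwards. [cite: SalmhoferSeiler1991, (3.86)] -/
theorem crossDown_of_ne {μ : Fin ν} (hμ : μ ≠ i) : crossDown i k μ = ∅ := by
  ext x
  simp only [crossDown, Finset.mem_filter, Finset.notMem_empty, iff_false, not_and]
  intro hx hx'
  exact ((not_mem_halfPlus_iff i k x).2 hx) ((add_single_mem_halfPlus_iff i k x hμ).1 hx')

/-- The links of direction `μ` starting in `Λ₊` are the internal ones and the upward crossing ones.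
[cite: SalmhoferSeiler1991, (3.84)–(3.86)] -/
theorem sum_halfPlus_eq_sum_plusLinkStarts_add (μ : Fin ν) (g : TorusSite ν L → FieldAlg ν L) :
    ∑ x ∈ halfPlus L i k, g x = ∑ x ∈ plusLinkStarts i k μ, g x + ∑ x ∈ crossUp i k μ, g x := by
  rw [plusLinkStarts, crossUp, Finset.sum_filter_add_sum_filter_not]

/-- The links of direction `μ` starting in `Λ₋` are the downward crossing ones and the internal
ones. [cite: SalmhoferSeiler1991, (3.84)–(3.86)] -/
theorem sum_halfMinus_eq_sum_crossDown_add (μ : Fin ν) (g : TorusSite ν L → FieldAlg ν L) :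
    ∑ x ∈ halfMinus L i k, g x = ∑ x ∈ crossDown i k μ, g x + ∑ x ∈ minusLinkStarts i k μ, g x := by
  rw [crossDown, minusLinkStarts, Finset.sum_filter_add_sum_filter_not]

/-- A sum over all sites splits into the two halves. [cite: SalmhoferSeiler1991, Def. 3.13 (p. 410)] -/
theorem sum_univ_eq_sum_halfPlus_add_sum_halfMinus (g : TorusSite ν L → FieldAlg ν L) :
    ∑ x, g x = ∑ x ∈ halfPlus L i k, g x + ∑ x ∈ halfMinus L i k, g x := by
  rw [← Finset.sum_filter_add_sum_filter_not univ (fun x => x ∈ halfPlus L i k),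
    univ_filter_mem_halfPlus, univ_filter_not_mem_halfPlus]

end Links

/-! ### The half-space Hamiltonian `-N H^ε_{Λ₊}(φ)` and the crossing terms `H_C` -/

section PlusHam

variable (i : Fin ν) (k : ZMod L)

/-- **The observable `-N H^ε_{Λ₊}(φ)`** (3.85): the site terms `-Nεν(σ_x - φ_x)²`, `x ∈ Λ₊`, and the
link terms `N(σ_x - φ_x)(σ_{x+e_μ} - φ_{x+e_μ})` of the links with both endpoints in `Λ₊`.
[cite: SalmhoferSeiler1991, (3.85)] -/
def plusHam (ε : ℤ) (N : ℕ) (ψ : TorusSite ν L → ℂ) : FieldAlg ν L :=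
  ∑ x ∈ halfPlus L i k, siteTerm ε N ψ x +
    ∑ μ : Fin ν, ∑ x ∈ plusLinkStarts i k μ, linkTerm N ψ (x, μ)

/-- The mirror observable `-N H^ε_{Λ₋}(φ)`: site terms over `Λ₋` and link terms of the links with both
endpoints in `Λ₋`. [cite: SalmhoferSeiler1991, (3.84)] -/
def minusHam (ε : ℤ) (N : ℕ) (ψ : TorusSite ν L → ℂ) : FieldAlg ν L :=
  ∑ x ∈ halfMinus L i k, siteTerm ε N ψ x +
    ∑ μ : Fin ν, ∑ x ∈ minusLinkStarts i k μ, linkTerm N ψ (x, μ)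

/-- The index set of the crossing links: upward crossings `(x, x + e_i)`, `x ∈ Λ₊`, and downward
crossings `(x, x + e_i)`, `x ∈ Λ₋` (the sum `∑_{x : x_1 ∈ {0, L_1}}` of (3.86)–(3.87)).
[cite: SalmhoferSeiler1991, (3.86)–(3.87)] -/
abbrev CrossIdx : Type := {x // x ∈ crossUp i k i} ⊕ {x // x ∈ crossDown i k i}

/-- The endpoint in `Λ₊` of a crossing link. [cite: SalmhoferSeiler1991, (3.86)–(3.88)] -/
def crossSite : CrossIdx i k → TorusSite ν L :=
  Sum.elim (fun x => x.1) (fun x => x.1 + Pi.single i 1)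

/-- `C_x = σ_x - φ_x` (3.88), at the `Λ₊`-endpoint of a crossing link. [cite: SalmhoferSeiler1991, (3.88)] -/
def crossC (ψ : TorusSite ν L → ℂ) : CrossIdx i k → FieldAlg ν L :=
  fun j => X (crossSite i k j) - C (ψ (crossSite i k j))

/-- `D_x = σ_x - conj φ_{rx}` (3.88), at the `Λ₊`-endpoint of a crossing link. [cite: SalmhoferSeiler1991, (3.88)] -/
def crossD (ψ : TorusSite ν L → ℂ) : CrossIdx i k → FieldAlg ν L :=
  fun j => X (crossSite i k j) - C (starRingEnd ℂ (ψ (siteReflect i k (crossSite i k j))))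

/-- The couplings `N` of the crossing terms `-N H_C = ∑ N C_x ΘD_x`. [cite: SalmhoferSeiler1991, (3.87)] -/
def crossW (N : ℕ) : CrossIdx i k → ℝ := fun _ => N

variable {i k}

/-- The `Λ₊`-endpoint of a crossing link lies in `Λ₊`. [cite: SalmhoferSeiler1991, (3.86)–(3.88)] -/
theorem crossSite_mem (j : CrossIdx i k) : crossSite i k j ∈ halfPlus L i k := by
  rcases j with ⟨x, hx⟩ | ⟨x, hx⟩
  · exact (mem_crossUp.1 hx).1
  · exact (mem_crossDown.1 hx).2

/-- The mirror image of the `Λ₊`-endpoint of a crossing link lies in `Λ₋` (even side).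
[cite: SalmhoferSeiler1991, (3.86)–(3.88)] -/
theorem siteReflect_crossSite_mem (hL : Even L) (j : CrossIdx i k) :
    siteReflect i k (crossSite i k j) ∈ halfMinus L i k :=
  cellReflect_mem_halfMinus hL (crossSite_mem j)

/-- The couplings are nonnegative. [cite: SalmhoferSeiler1991, (3.87)] -/
theorem crossW_nonneg (N : ℕ) (j : CrossIdx i k) : 0 ≤ crossW i k N j := Nat.cast_nonneg N

/-- `C_x ∈ 𝒜_{Λ₊}`. [cite: SalmhoferSeiler1991, (3.88)] -/
theorem crossC_mem (ψ : TorusSite ν L → ℂ) (j : CrossIdx i k) : crossC i k ψ j ∈ plusAlgebra i k :=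
  Subalgebra.sub_mem _ (X_mem_plusAlgebra (crossSite_mem j)) (C_mem_plusAlgebra i k _)

/-- `D_x ∈ 𝒜_{Λ₊}`. [cite: SalmhoferSeiler1991, (3.88)] -/
theorem crossD_mem (ψ : TorusSite ν L → ℂ) (j : CrossIdx i k) : crossD i k ψ j ∈ plusAlgebra i k :=
  Subalgebra.sub_mem _ (X_mem_plusAlgebra (crossSite_mem j)) (C_mem_plusAlgebra i k _)

/-- An upward crossing link term is `N · C_x · ΘD_x` (3.87). [cite: SalmhoferSeiler1991, (3.86)–(3.88)] -/
theorem crossExp_inl (hL : Even L) (N : ℕ) (ψ : TorusSite ν L → ℂ) (x : {x // x ∈ crossUp i k i}) :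
    crossExp i k (crossW i k N) (crossC i k ψ) (crossD i k ψ) (Sum.inl x) = linkTerm N ψ (x.1, i) := by
  obtain ⟨hx, hx'⟩ := mem_crossUp.1 x.2
  rw [linkTerm_eq_crossExp hL N ψ hx hx']
  simp only [crossExp, crossW, crossC, crossD, crossSite, Sum.elim_inl]

/-- A downward crossing link term is `N · C_y · ΘD_y` with `y = x + e_i` (3.87). [cite: SalmhoferSeiler1991, (3.86)–(3.88)] -/
theorem crossExp_inr (hL : Even L) (N : ℕ) (ψ : TorusSite ν L → ℂ) (x : {x // x ∈ crossDown i k i}) :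
    crossExp i k (crossW i k N) (crossC i k ψ) (crossD i k ψ) (Sum.inr x) =
      linkTerm N ψ (x.1, i) := by
  obtain ⟨hx, hx'⟩ := mem_crossDown.1 x.2
  rw [linkTerm_eq_crossExp' hL N ψ hx hx']
  simp only [crossExp, crossW, crossC, crossD, crossSite, Sum.elim_inr]

/-- **`-N H_C(φ) = ∑ N C_x ΘD_x`**: the sum of the crossing exponents is the sum of the crossing link
terms. [cite: SalmhoferSeiler1991, (3.86)–(3.87)] -/
theorem sum_crossExp (hL : Even L) (N : ℕ) (ψ : TorusSite ν L → ℂ) :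
    ∑ j, crossExp i k (crossW i k N) (crossC i k ψ) (crossD i k ψ) j =
      ∑ x ∈ crossUp i k i, linkTerm N ψ (x, i) + ∑ x ∈ crossDown i k i, linkTerm N ψ (x, i) := by
  rw [Fintype.sum_sum_type]
  simp_rw [crossExp_inl hL, crossExp_inr hL]
  rw [Finset.sum_coe_sort (crossUp i k i) (fun x => linkTerm N ψ (x, i)),
    Finset.sum_coe_sort (crossDown i k i) (fun x => linkTerm N ψ (x, i))]

/-- `-N H^ε_{Λ₊}(φ) ∈ 𝒜_{Λ₊}`. [cite: SalmhoferSeiler1991, (3.85)] -/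
theorem plusHam_mem (ε : ℤ) (N : ℕ) (ψ : TorusSite ν L → ℂ) : plusHam i k ε N ψ ∈ plusAlgebra i k := by
  refine Subalgebra.add_mem _ (Subalgebra.sum_mem _ fun x hx => ?_)
    (Subalgebra.sum_mem _ fun μ _ => Subalgebra.sum_mem _ fun x hx => ?_)
  · exact Subalgebra.mul_mem _ (C_mem_plusAlgebra i k _)
      (Subalgebra.pow_mem _ (Subalgebra.sub_mem _ (X_mem_plusAlgebra hx) (C_mem_plusAlgebra i k _)) _)
  · obtain ⟨hx₁, hx₂⟩ := mem_plusLinkStarts.1 hx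
    exact Subalgebra.mul_mem _ (C_mem_plusAlgebra i k _) (Subalgebra.mul_mem _
      (Subalgebra.sub_mem _ (X_mem_plusAlgebra hx₁) (C_mem_plusAlgebra i k _))
      (Subalgebra.sub_mem _ (X_mem_plusAlgebra hx₂) (C_mem_plusAlgebra i k _)))

/-- `-N H^ε_{Λ₊}(φ)` depends only on `φ|_{Λ₊}`. [cite: SalmhoferSeiler1991, (3.85)] -/
theorem plusHam_congr {ε : ℤ} {N : ℕ} {ψ ψ' : TorusSite ν L → ℂ}
    (h : ∀ y ∈ halfPlus L i k, ψ y = ψ' y) : plusHam i k ε N ψ = plusHam i k ε N ψ' := by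
  unfold plusHam
  refine congrArg₂ (· + ·) (Finset.sum_congr rfl fun x hx => ?_)
    (Finset.sum_congr rfl fun μ _ => Finset.sum_congr rfl fun x hx => ?_)
  · rw [siteTerm, siteTerm, h x hx]
  · obtain ⟨hx₁, hx₂⟩ := mem_plusLinkStarts.1 hx
    rw [linkTerm, linkTerm, h _ hx₁, h _ hx₂]

/-- **`Θ(-N H^ε_{Λ₊}(φ̄ ∘ r)) = -N H^ε_{Λ₋}(φ)`**: the reflected half-space Hamiltonian of the mirror
configuration is the half-space Hamiltonian of the negative half. [cite: SalmhoferSeiler1991, (3.84)] -/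
theorem reflect_plusHam_mirrorCfg (hL : Even L) (ε : ℤ) (N : ℕ) (ψ : TorusSite ν L → ℂ) :
    reflect i k (plusHam i k ε N (mirrorCfg i k ψ)) = minusHam i k ε N ψ := by
  unfold plusHam minusHam
  rw [map_add, map_sum, map_sum]
  refine congrArg₂ (· + ·) ?_ (Finset.sum_congr rfl fun μ _ => ?_)
  · -- sites: `Λ₋ = r Λ₊`
    rw [halfMinus_eq_image hL, Finset.sum_image fun x _ y _ h => (siteReflect i k).injective h]
    exact Finset.sum_congr rfl fun x _ => reflect_siteTerm_mirrorCfg ε N ψ x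
  · rw [map_sum]
    by_cases hμ : μ = i
    · subst hμ
      -- direction `i`: the internal links of `Λ₋` are the images of those of `Λ₊` under
      -- `x ↦ r(x + e_i)`
      have hψ : ∀ x : TorusSite ν L,
          siteReflect μ k (siteReflect μ k (x + Pi.single μ 1) + Pi.single μ 1) = x := fun x => by
        rw [siteReflect_add_single_self, siteReflect_siteReflect]
      symm
      refine Finset.sum_nbij' (fun x => siteReflect μ k (x + Pi.single μ 1))
        (fun x => siteReflect μ k (x + Pi.single μ 1)) ?_ ?_ (fun x _ => hψ x) (fun x _ => hψ x) ?_
      · intro x hx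
        rw [mem_minusLinkStarts] at hx
        rw [mem_plusLinkStarts, siteReflect_add_single_self]
        exact ⟨cellReflect_mem_halfPlus hL hx.2, cellReflect_mem_halfPlus hL hx.1⟩
      · intro x hx
        rw [mem_plusLinkStarts] at hx
        rw [mem_minusLinkStarts, siteReflect_add_single_self]
        exact ⟨cellReflect_mem_halfMinus hL hx.2, cellReflect_mem_halfMinus hL hx.1⟩
      · intro x _
        rw [reflect_linkTerm_mirrorCfg_self, hψ]
    · -- direction `μ ≠ i`: `x ↦ r x`
      symm
      refine Finset.sum_nbij' (fun x => siteReflect i k x) (fun x => siteReflect i k x) ?_ ?_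
        (fun x _ => siteReflect_siteReflect i k x) (fun x _ => siteReflect_siteReflect i k x) ?_
      · intro x hx
        rw [mem_minusLinkStarts] at hx
        rw [mem_plusLinkStarts, ← siteReflect_add_single_of_ne i k x hμ]
        exact ⟨cellReflect_mem_halfPlus hL hx.1, cellReflect_mem_halfPlus hL hx.2⟩
      · intro x hx
        rw [mem_plusLinkStarts] at hx
        rw [mem_minusLinkStarts, ← siteReflect_add_single_of_ne i k x hμ]
        exact ⟨cellReflect_mem_halfMinus hL hx.1, cellReflect_mem_halfMinus hL hx.2⟩
      · intro x _
        rw [reflect_linkTerm_mirrorCfg_of_ne N ψ hμ, siteReflect_siteReflect]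

/-- **(3.84): `-N H^ε_Λ(φ) = -N H^ε_{Λ₊}(φ) + Θ(-N H^ε_{Λ₊}(φ̄∘r)) + ∑ N C_x ΘD_x`** — the family of
site and link terms of `-N H^ε_Λ(φ)` regrouped relative to the reflection plane.
[cite: SalmhoferSeiler1991, (3.84)–(3.87)] -/
theorem sum_hamFamily_eq_plusHam (hL : Even L) (ε : ℤ) (N : ℕ) (ψ : TorusSite ν L → ℂ) :
    ∑ j, hamFamily ε N ψ j =
      plusHam i k ε N ψ + reflect i k (plusHam i k ε N (mirrorCfg i k ψ)) +
        ∑ j, crossExp i k (crossW i k N) (crossC i k ψ) (crossD i k ψ) j := by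
  rw [reflect_plusHam_mirrorCfg hL, sum_crossExp hL, Fintype.sum_sum_type]
  simp only [hamFamily, Sum.elim_inl, Sum.elim_inr]
  rw [Fintype.sum_prod_type, Finset.sum_comm,
    sum_univ_eq_sum_halfPlus_add_sum_halfMinus (i := i) (k := k) (siteTerm ε N ψ)]
  have hlinks : ∀ μ : Fin ν, ∑ x, linkTerm N ψ (x, μ) =
      (∑ x ∈ plusLinkStarts i k μ, linkTerm N ψ (x, μ) + ∑ x ∈ crossUp i k μ, linkTerm N ψ (x, μ)) +
        (∑ x ∈ crossDown i k μ, linkTerm N ψ (x, μ) +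
          ∑ x ∈ minusLinkStarts i k μ, linkTerm N ψ (x, μ)) := fun μ => by
    rw [sum_univ_eq_sum_halfPlus_add_sum_halfMinus (i := i) (k := k),
      sum_halfPlus_eq_sum_plusLinkStarts_add μ, sum_halfMinus_eq_sum_crossDown_add μ]
  simp_rw [hlinks, Finset.sum_add_distrib]
  have hup : ∑ μ : Fin ν, ∑ x ∈ crossUp i k μ, linkTerm N ψ (x, μ) =
      ∑ x ∈ crossUp i k i, linkTerm N ψ (x, i) := by
    rw [Finset.sum_eq_single i (fun μ _ hμ => by rw [crossUp_of_ne hμ, Finset.sum_empty])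
      (fun h => absurd (Finset.mem_univ i) h)]
  have hdown : ∑ μ : Fin ν, ∑ x ∈ crossDown i k μ, linkTerm N ψ (x, μ) =
      ∑ x ∈ crossDown i k i, linkTerm N ψ (x, i) := by
    rw [Finset.sum_eq_single i (fun μ _ hμ => by rw [crossDown_of_ne hμ, Finset.sum_empty])
      (fun h => absurd (Finset.mem_univ i) h)]
  rw [hup, hdown, plusHam, minusHam]
  ring

end PlusHam

/-! ### The exponential factor of an observable; the regrouped exponential bracket -/

section ExpFactor

variable {i : Fin ν} {k : ZMod L}

omit [NeZero L] in
/-- Constant terms are additive. [cite: SalmhoferSeiler1991, Thm. 3.20 (proof)] -/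
theorem cst_add (P Q : FieldAlg ν L) : cst (P + Q) = cst P + cst Q := coeff_add 0 P Q

omit [NeZero L] in
/-- Constant terms of finite sums. [cite: SalmhoferSeiler1991, Thm. 3.20 (proof)] -/
theorem cst_sum {α : Type*} (s : Finset α) (g : α → FieldAlg ν L) :
    cst (∑ a ∈ s, g a) = ∑ a ∈ s, cst (g a) := coeff_sum s g 0

omit [NeZero L] in
/-- Constant-free parts are additive. [cite: SalmhoferSeiler1991, Thm. 3.20 (proof)] -/
theorem tail_add (P Q : FieldAlg ν L) : tail (P + Q) = tail P + tail Q := by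
  simp only [tail, coeff_add, map_add]
  ring

omit [NeZero L] in
/-- Constant-free parts of finite sums. [cite: SalmhoferSeiler1991, Thm. 3.20 (proof)] -/
theorem tail_sum {α : Type*} (s : Finset α) (g : α → FieldAlg ν L) :
    tail (∑ a ∈ s, g a) = ∑ a ∈ s, tail (g a) := by
  simp only [tail, coeff_sum, map_sum, Finset.sum_sub_distrib]

/-- **The exponential factor** `e^{q₀} · e_D^{Q - q₀}` of an observable `Q` with constant term `q₀`
(the polynomial standing for `e^{Q}` under the bracket: `e^A`, `Θe^B` of (3.70)/(3.84)).
[cite: SalmhoferSeiler1991, Thm. 3.20 (3.70) and (3.84)] -/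
def expFactor (D : ℕ) (Q : FieldAlg ν L) : FieldAlg ν L :=
  C (Complex.exp (cst Q)) * eT D (tail Q)

omit [NeZero L] in
/-- `Θ e^{Q} = e^{ΘQ}` for the exponential factors. [cite: SalmhoferSeiler1991, (3.84)] -/
theorem reflect_expFactor' (D : ℕ) (Q : FieldAlg ν L) :
    reflect i k (expFactor D Q) = expFactor D (reflect i k Q) :=
  reflect_expFactor D Q

/-- `e^{Q} ∈ 𝒜_{Λ₊}` for `Q ∈ 𝒜_{Λ₊}`. [cite: SalmhoferSeiler1991, Thm. 3.20 (3.70)] -/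
theorem expFactor_mem {D : ℕ} {Q : FieldAlg ν L} (hQ : Q ∈ plusAlgebra i k) :
    expFactor D Q ∈ plusAlgebra i k :=
  Subalgebra.mul_mem _ (C_mem_plusAlgebra i k _)
    (eT_mem_plusAlgebra D (Subalgebra.sub_mem _ hQ (C_mem_plusAlgebra i k _)))

/-- **Regrouping the exponential bracket**: with two exponential factors in front,
`[e^{A} e^{B} · e^{∑_j Q_j}]_Λ = e^{c₀} [e_D^{T - c₀}]_Λ`, `T = A + B + ∑_j Q_j`, `c₀` its constant
term — the exponential bracket depends only on the total exponent (the exponential series of a sum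
is the product of the series, modulo observables invisible to the bracket).
[cite: SalmhoferSeiler1991, Thm. 3.20 (proof) and (3.84)] -/
theorem expBracketC_expFactor_mul (N : ℕ) (f b : ℕ → ℝ) {ι : Type*} [Fintype ι]
    (A B : FieldAlg ν L) (Q : ι → FieldAlg ν L) :
    expBracketC N f b (expFactor (topDegree ν L N) A * expFactor (topDegree ν L N) B) Q =
      Complex.exp (cst (A + B + ∑ j, Q j)) *
        bracketC N f b (eT (topDegree ν L N) (tail (A + B + ∑ j, Q j))) := by
  classical
  unfold expBracketC expFactor
  have hpoly : C (Complex.exp (cst A)) * eT (topDegree ν L N) (tail A) *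
      (C (Complex.exp (cst B)) * eT (topDegree ν L N) (tail B)) *
        ∏ j, eT (topDegree ν L N) (tail (Q j)) =
      C (Complex.exp (cst A) * Complex.exp (cst B)) *
        (1 * (eT (topDegree ν L N) (tail A) * eT (topDegree ν L N) (tail B) *
          ∏ j, eT (topDegree ν L N) (tail (Q j)))) := by
    rw [map_mul]; ring
  rw [hpoly, bracketC_C_mul]
  have hnull : NullEq (topDegree ν L N) (eT (topDegree ν L N) (tail (A + B + ∑ j, Q j)))
      (eT (topDegree ν L N) (tail A) * eT (topDegree ν L N) (tail B) *
        ∏ j, eT (topDegree ν L N) (tail (Q j))) := by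
    rw [tail_add, tail_add, tail_sum]
    refine (eT_add_nullEq (topDegree ν L N) ?_ ?_).trans
      ((eT_add_nullEq (topDegree ν L N) (coeff_zero_tail A) (coeff_zero_tail B)).mul
        (eT_sum_nullEq (topDegree ν L N) _ fun j _ => coeff_zero_tail (Q j)))
    · rw [coeff_add, coeff_zero_tail, coeff_zero_tail, add_zero]
    · rw [coeff_sum]; exact Finset.sum_eq_zero fun j _ => coeff_zero_tail (Q j)
  rw [← bracketC_congr_of_nullEq f b hnull 1, one_mul, cst_add, cst_add, cst_sum,
    Complex.exp_add, Complex.exp_add, Complex.exp_sum]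
  ring

variable (i k)

/-- **The twisted partition function as a reflection-split exponential bracket** ((3.84) inside
(3.80)): `Z^ε_Λ(φ) = [e^{-N H^ε_{Λ₊}(φ)} · Θ e^{-N H^ε_{Λ₊}(φ̄∘r)} · e^{∑ N C_x ΘD_x}]_Λ`, the form to
which Thm. 3.20 applies. [cite: SalmhoferSeiler1991, (3.84)–(3.89)] -/
theorem twistedZ_eq_expBracketC (hL : Even L) (ε : ℤ) (N : ℕ) (f b : ℕ → ℝ)
    (ψ : TorusSite ν L → ℂ) :
    twistedZ ε N f b ψ =
      expBracketC N f b (expFactor (topDegree ν L N) (plusHam i k ε N ψ) *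
          reflect i k (expFactor (topDegree ν L N) (plusHam i k ε N (mirrorCfg i k ψ))))
        (crossExp i k (crossW i k N) (crossC i k ψ) (crossD i k ψ)) := by
  rw [reflect_expFactor', expBracketC_expFactor_mul, ← sum_hamFamily_eq_plusHam hL, twistedZ,
    expBracketC_one_eq, cst_sum, tail_sum]

variable {i k}

/-! ### The symmetrised configurations have the diagonal data (the two factors of (3.90)) -/

/-- `H_{Λ₊}` of the positive symmetrisation is `H_{Λ₊}(φ)`. [cite: SalmhoferSeiler1991, (3.90)] -/
theorem plusHam_cfgSymP (ε : ℤ) (N : ℕ) (ψ : TorusSite ν L → ℂ) :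
    plusHam i k ε N (cfgSymP i k ψ) = plusHam i k ε N ψ :=
  plusHam_congr fun _ hy => cfgSymP_of_mem hy

/-- The mirror of the positive symmetrisation is `φ` on `Λ₊`. [cite: SalmhoferSeiler1991, (3.90)] -/
theorem plusHam_mirrorCfg_cfgSymP (hL : Even L) (ε : ℤ) (N : ℕ) (ψ : TorusSite ν L → ℂ) :
    plusHam i k ε N (mirrorCfg i k (cfgSymP i k ψ)) = plusHam i k ε N ψ :=
  plusHam_congr fun y hy => by
    rw [mirrorCfg_apply, cfgSymP_of_mem_halfMinus (cellReflect_mem_halfMinus hL hy),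
      siteReflect_siteReflect, starRingEnd_self_apply]

/-- `H_{Λ₊}` of the negative symmetrisation is `H_{Λ₊}(φ̄∘r)`. [cite: SalmhoferSeiler1991, (3.90)] -/
theorem plusHam_cfgSymM (ε : ℤ) (N : ℕ) (ψ : TorusSite ν L → ℂ) :
    plusHam i k ε N (cfgSymM i k ψ) = plusHam i k ε N (mirrorCfg i k ψ) :=
  plusHam_congr fun y hy => by rw [cfgSymM_of_mem_halfPlus hy, mirrorCfg_apply]

/-- The mirror of the negative symmetrisation is `φ̄∘r` on `Λ₊`. [cite: SalmhoferSeiler1991, (3.90)] -/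
theorem plusHam_mirrorCfg_cfgSymM (hL : Even L) (ε : ℤ) (N : ℕ) (ψ : TorusSite ν L → ℂ) :
    plusHam i k ε N (mirrorCfg i k (cfgSymM i k ψ)) = plusHam i k ε N (mirrorCfg i k ψ) :=
  plusHam_congr fun y hy => by
    rw [mirrorCfg_apply, mirrorCfg_apply, cfgSymM_of_mem (cellReflect_mem_halfMinus hL hy)]

/-- `C` of the positive symmetrisation. [cite: SalmhoferSeiler1991, (3.88)–(3.90)] -/
theorem crossC_cfgSymP (ψ : TorusSite ν L → ℂ) : crossC i k (cfgSymP i k ψ) = crossC i k ψ :=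
  funext fun j => by rw [crossC, crossC, cfgSymP_of_mem (crossSite_mem j)]

/-- `D` of the positive symmetrisation is `C`. [cite: SalmhoferSeiler1991, (3.88)–(3.90)] -/
theorem crossD_cfgSymP (hL : Even L) (ψ : TorusSite ν L → ℂ) :
    crossD i k (cfgSymP i k ψ) = crossC i k ψ :=
  funext fun j => by
    rw [crossD, crossC, cfgSymP_of_mem_halfMinus (siteReflect_crossSite_mem hL j),
      siteReflect_siteReflect, starRingEnd_self_apply]

/-- `C` of the negative symmetrisation is `D`. [cite: SalmhoferSeiler1991, (3.88)–(3.90)] -/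
theorem crossC_cfgSymM (ψ : TorusSite ν L → ℂ) : crossC i k (cfgSymM i k ψ) = crossD i k ψ :=
  funext fun j => by rw [crossC, crossD, cfgSymM_of_mem_halfPlus (crossSite_mem j)]

/-- `D` of the negative symmetrisation. [cite: SalmhoferSeiler1991, (3.88)–(3.90)] -/
theorem crossD_cfgSymM (hL : Even L) (ψ : TorusSite ν L → ℂ) :
    crossD i k (cfgSymM i k ψ) = crossD i k ψ :=
  funext fun j => by rw [crossD, crossD, cfgSymM_of_mem (siteReflect_crossSite_mem hL j)]

/-! ### The reflection Schwarz inequality (3.90) and Gaussian domination (3.95), (3.97) -/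

/-- **(3.90)**: "Using Theorem 3.20 which is applicable because `[·]_Λ` is reflection-positive
(normalization does not matter), one sees that `|F_ε(φ)|² ≤ F_ε(φ₊-symmetrised) F_ε(φ₋-symmetrised)`":
`|Z^ε_Λ(ψ)|² ≤ Z^ε_Λ(ψ on Λ₊, ψ̄∘r on Λ₋) · Z^ε_Λ(ψ̄∘r on Λ₊, ψ on Λ₋)`, for the background bracket
with site data `f` and bond data `b ≥ 0`, every plane `(i, k)` of the even torus.
[cite: SalmhoferSeiler1991, (3.90)] -/
theorem twistedZ_schwarz (hL : Even L) (i : Fin ν) (k : ZMod L) (ε : ℤ) {N : ℕ} (f : ℕ → ℝ)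
    {b : ℕ → ℝ} (hb : ∀ j ≤ N, 0 ≤ b j) (ψ : TorusSite ν L → ℂ) :
    ‖twistedZ ε N f b ψ‖ ^ 2 ≤
      (twistedZ ε N f b (cfgSymP i k ψ)).re * (twistedZ ε N f b (cfgSymM i k ψ)).re := by
  rw [twistedZ_eq_expBracketC i k hL ε N f b ψ, twistedZ_eq_expBracketC i k hL ε N f b (cfgSymP i k ψ),
    twistedZ_eq_expBracketC i k hL ε N f b (cfgSymM i k ψ), plusHam_cfgSymP,
    plusHam_mirrorCfg_cfgSymP hL, crossC_cfgSymP, crossD_cfgSymP hL, plusHam_cfgSymM,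
    plusHam_mirrorCfg_cfgSymM hL, crossC_cfgSymM, crossD_cfgSymM hL]
  exact expBracketC_schwarz hL i k f hb (crossW_nonneg N) (expFactor_mem (plusHam_mem ε N ψ))
    (expFactor_mem (plusHam_mem ε N _)) (crossC_mem ψ) (crossD_mem ψ)

/-- The first factor of (3.90) is real and nonnegative. [cite: SalmhoferSeiler1991, (3.90)] -/
theorem twistedZ_cfgSymP_real (hL : Even L) (i : Fin ν) (k : ZMod L) (ε : ℤ) {N : ℕ} (f : ℕ → ℝ)
    {b : ℕ → ℝ} (hb : ∀ j ≤ N, 0 ≤ b j) (ψ : TorusSite ν L → ℂ) :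
    twistedZ ε N f b (cfgSymP i k ψ) = ((twistedZ ε N f b (cfgSymP i k ψ)).re : ℂ) ∧
      0 ≤ (twistedZ ε N f b (cfgSymP i k ψ)).re := by
  rw [twistedZ_eq_expBracketC i k hL ε N f b (cfgSymP i k ψ), plusHam_cfgSymP,
    plusHam_mirrorCfg_cfgSymP hL, crossC_cfgSymP, crossD_cfgSymP hL]
  exact expBracketC_diag hL i k f hb (crossW_nonneg N) (expFactor_mem (plusHam_mem ε N ψ))
    (crossC_mem ψ)

/-- The second factor of (3.90) is real and nonnegative. [cite: SalmhoferSeiler1991, (3.90)] -/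
theorem twistedZ_cfgSymM_real (hL : Even L) (i : Fin ν) (k : ZMod L) (ε : ℤ) {N : ℕ} (f : ℕ → ℝ)
    {b : ℕ → ℝ} (hb : ∀ j ≤ N, 0 ≤ b j) (ψ : TorusSite ν L → ℂ) :
    twistedZ ε N f b (cfgSymM i k ψ) = ((twistedZ ε N f b (cfgSymM i k ψ)).re : ℂ) ∧
      0 ≤ (twistedZ ε N f b (cfgSymM i k ψ)).re := by
  rw [twistedZ_eq_expBracketC i k hL ε N f b (cfgSymM i k ψ), plusHam_cfgSymM,
    plusHam_mirrorCfg_cfgSymM hL, crossC_cfgSymM, crossD_cfgSymM hL]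
  exact expBracketC_diag hL i k f hb (crossW_nonneg N) (expFactor_mem (plusHam_mem ε N _))
    (crossD_mem ψ)

/-- The positive symmetrisation of the zero configuration is zero. [cite: SalmhoferSeiler1991, (3.90)] -/
theorem cfgSymP_zero (i : Fin ν) (k : ZMod L) :
    cfgSymP i k (fun _ : TorusSite ν L => (0 : ℂ)) = fun _ => 0 :=
  funext fun y => by unfold cfgSymP; split_ifs <;> simp

/-- **`Z^ε_Λ(0)` is real and nonnegative** (it is a diagonal exponential bracket; torus of positive
dimension). [cite: SalmhoferSeiler1991, (3.80) and (3.90)] -/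
theorem twistedZ_zero_real (hL : Even L) (i : Fin ν) (k : ZMod L) (ε : ℤ) {N : ℕ} (f : ℕ → ℝ)
    {b : ℕ → ℝ} (hb : ∀ j ≤ N, 0 ≤ b j) :
    twistedZ ε N f b (fun _ : TorusSite ν L => (0 : ℂ)) =
        ((twistedZ ε N f b (fun _ : TorusSite ν L => (0 : ℂ))).re : ℂ) ∧
      0 ≤ (twistedZ ε N f b (fun _ : TorusSite ν L => (0 : ℂ))).re := by
  have h := twistedZ_cfgSymP_real hL i k ε f hb (fun _ => 0)
  rwa [cfgSymP_zero] at h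

omit [NeZero L] in
/-- The norm of a real nonnegative complex number is its real part. [folklore] -/
private theorem norm_eq_re_of_eq {z : ℂ} (h : z = (z.re : ℂ)) (h0 : 0 ≤ z.re) : ‖z‖ = z.re := by
  rw [h, Complex.ofReal_re, Complex.norm_real, Real.norm_of_nonneg h0]

/-- **The chessboard bound (3.91)–(3.93) for `|Z^ε_Λ|`**: every configuration with values in a finite
conjugation-closed set `S` is dominated by a homogeneous one, `|Z^ε_Λ(φ)| ≤ |Z^ε_Λ(Φ^{(c)})|`.
[cite: SalmhoferSeiler1991, (3.91)–(3.93)] -/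
theorem norm_twistedZ_le_pattern (hL : Even L) (ε : ℤ) {N : ℕ} (f : ℕ → ℝ) {b : ℕ → ℝ}
    (hb : ∀ j ≤ N, 0 ≤ b j) {S : Finset ℂ} (hS : ∀ c ∈ S, starRingEnd ℂ c ∈ S)
    {φ : TorusSite ν L → ℂ} (hφ : ∀ y, φ y ∈ S) :
    ∃ c ∈ S, ∃ p₀ : ZMod 2,
      ‖twistedZ ε N f b φ‖ ≤ ‖twistedZ ε N f b (pattern (ν := ν) hL.two_dvd c p₀)‖ := by
  refine chessboard_cfg hL hS (F := fun ψ => ‖twistedZ ε N f b ψ‖) (fun _ => norm_nonneg _)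
    (fun i k ψ _ => ?_) hφ (fun _ => 0)
  obtain ⟨hP, hP0⟩ := twistedZ_cfgSymP_real hL i k ε f hb ψ
  obtain ⟨hM, hM0⟩ := twistedZ_cfgSymM_real hL i k ε f hb ψ
  show ‖twistedZ ε N f b ψ‖ ^ 2 ≤ ‖twistedZ ε N f b (cfgSymP i k ψ)‖ * ‖twistedZ ε N f b (cfgSymM i k ψ)‖
  rw [norm_eq_re_of_eq hP hP0, norm_eq_re_of_eq hM hM0]
  exact twistedZ_schwarz hL i k ε f hb ψ

/-- **Gaussian domination, `ε = 1` (3.95)**: "For `ε = 1`, take `φ_x ∈ ℝ` for all `x`, then `Φ^{(x)}`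
is a constant configuration, and `H⁺_Λ(Φ^{(x)}) = H⁺_Λ(0)`, that is, `Z⁺_Λ(Φ^{(x)}) = Z_Λ` and
consequently Gaussian domination `|Z⁺_Λ(φ)| ≤ Z_Λ` holds" — here `|Z⁺_Λ(φ)| ≤ |Z⁺_Λ(0)|` for every real
configuration, background bracket with site data `f` and bond data `b ≥ 0`.
[cite: SalmhoferSeiler1991, (3.94)–(3.95)] -/
theorem gaussianDomination_one (hL : Even L) {N : ℕ} (f : ℕ → ℝ) {b : ℕ → ℝ}
    (hb : ∀ j ≤ N, 0 ≤ b j) {φ : TorusSite ν L → ℂ} (hφ : ∀ y, starRingEnd ℂ (φ y) = φ y) :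
    ‖twistedZ 1 N f b φ‖ ≤ ‖twistedZ 1 N f b (fun _ : TorusSite ν L => (0 : ℂ))‖ := by
  classical
  have hS : ∀ c ∈ Finset.univ.image φ, starRingEnd ℂ c ∈ Finset.univ.image φ := by
    intro c hc
    obtain ⟨y, -, rfl⟩ := Finset.mem_image.1 hc
    rw [hφ y]
    exact Finset.mem_image_of_mem φ (Finset.mem_univ y)
  obtain ⟨c, hc, p₀, hle⟩ := norm_twistedZ_le_pattern hL 1 f hb hS
    (fun y => Finset.mem_image_of_mem φ (Finset.mem_univ y))
  obtain ⟨y, -, rfl⟩ := Finset.mem_image.1 hc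
  have hconst : pattern (ν := ν) hL.two_dvd (φ y) p₀ = fun _ => φ y :=
    funext fun z => by unfold pattern; rw [hφ y, ite_self]
  rwa [hconst, twistedZ_one_const] at hle

/-- **Gaussian domination, `ε = -1` (3.97)**: "For `ε = -1`, take `φ_x ∈ iℝ`, then `Φ^{(x)}` is a
staggered configuration. Since `H⁻_Λ` is formally antiferromagnetic, `Z⁻_Λ(Φ^{(x)}) = Z_Λ`, and thus
`|Z⁻_Λ(φ)| ≤ Z_Λ`" — here `|Z⁻_Λ(φ)| ≤ |Z⁻_Λ(0)|` for every imaginary configuration.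
[cite: SalmhoferSeiler1991, (3.96)–(3.97)] -/
theorem gaussianDomination_negOne (hL : Even L) {N : ℕ} (f : ℕ → ℝ) {b : ℕ → ℝ}
    (hb : ∀ j ≤ N, 0 ≤ b j) {φ : TorusSite ν L → ℂ} (hφ : ∀ y, starRingEnd ℂ (φ y) = -φ y) :
    ‖twistedZ (-1) N f b φ‖ ≤ ‖twistedZ (-1) N f b (fun _ : TorusSite ν L => (0 : ℂ))‖ := by
  classical
  set S : Finset ℂ := Finset.univ.image φ ∪ Finset.univ.image (fun y => -φ y) with hSdef
  have hS : ∀ c ∈ S, starRingEnd ℂ c ∈ S := by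
    intro c hc
    rcases Finset.mem_union.1 hc with h | h
    · obtain ⟨y, -, rfl⟩ := Finset.mem_image.1 h
      rw [hφ y]
      exact Finset.mem_union_right _ (Finset.mem_image_of_mem (fun y => -φ y) (Finset.mem_univ y))
    · obtain ⟨y, -, rfl⟩ := Finset.mem_image.1 h
      rw [map_neg, hφ y, neg_neg]
      exact Finset.mem_union_left _ (Finset.mem_image_of_mem φ (Finset.mem_univ y))
  have hSc : ∀ c ∈ S, starRingEnd ℂ c = -c := by
    intro c hc
    rcases Finset.mem_union.1 hc with h | h
    · obtain ⟨y, -, rfl⟩ := Finset.mem_image.1 h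
      exact hφ y
    · obtain ⟨y, -, rfl⟩ := Finset.mem_image.1 h
      rw [map_neg, hφ y]
  have hφS : ∀ y, φ y ∈ S := fun y =>
    Finset.mem_union_left _ (Finset.mem_image_of_mem φ (Finset.mem_univ y))
  obtain ⟨c, hc, p₀, hle⟩ := norm_twistedZ_le_pattern hL (-1) f hb hS hφS
  rwa [twistedZ_negOne_pattern hL.two_dvd N f b (hSc c hc) p₀] at hle

end ExpFactor

end ComplexSpin

end Literature.MathematicalPhysics.StatisticalMechanics

end
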